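import Summits.BirchSwinnertonDyer.Rank1Residual.O5.AdditiveTamagawaThreeInvariantHolds
import Literature.NumberTheory.EllipticCurves.DivisionPolynomialMultiplication
import Literature.NumberTheory.EllipticCurves.TwoPowerTorsion
import HarnessLib

/-!
# O5 vocabulary: `NoLocalThreeTorsionAt W ℓ` IS `W(ℚ_ℓ)[3] = 0` (and `FullLocalThreeTorsionAt` is
# `h⁰ = 2`), and both transport along a mod-3 congruence with irreducible `W[3]` (cell `b2b-bsdres`, lane CLASS-CLOSURE, class O5; harvest seat 2,
# GEN 56, E111)

HONEST FRAMING (cell `b2b-bsdres`, run/shared/lean/b2b/bsd-rank1-residual/, verbatim in every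
file): the goal of the cell is to DELETE the COMBINATION-SHAPED residual classes of the
Birch–Swinnerton-Dyer formula for ALL analytic-rank `≤ 1` elliptic curves over `ℚ` — "full BSD
formula for every rank `≤ 1` curve in class `C`" assembled STRICTLY from published theorems — so
that the rank-`≤ 1` remainder becomes exactly the CONSTRUCTION-SHAPED classes, which are TYPED
(missing-input `Prop`s), NOT attempted. This is not "finishing BSD". Lane CLASS-CLOSURE: research
routes; no claim beyond the stated classes; nothing is booked here; no mark of `RESIDUAL-MAP.md`
moves; census numbers are EVIDENCE. THEOREMS ONLY (no definition, no named fact, no conjecture node;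
net named-fact debt `0`); no node file is touched; O5 stays OPEN.

## What this file does

`O5/O5KummerLine.lean` (cc-typer-5 GEN 5) types the census predicate
`NoLocalThreeTorsionAt W ℓ` — "no `ℚ_ℓ`-root `x₀` of `Ψ₃` with `Ψ₂²(x₀)` a square in `ℚ_ℓ`" — with
the docstring reading "**No `ℚ_ℓ`-rational 3-torsion**: `H⁰(ℚ_ℓ, W[3]) = 0`". This file proves that
reading in the kernel and draws the consequence that the predicate is SYMMETRIC along a mod-3
congruence (many O5 nodes carry it as a hypothesis on BOTH members of a congruent pair, e.g.
`DepthLawThree`, `AdditivePlacesFreeTransferThree`, `CertifiedSelmerTransferThree`):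

* §1 `exists_ne_zero_three_nsmul_iff_not_noLocalThreeTorsionAt` /
  `noLocalThreeTorsionAt_iff_forall_three_nsmul` — for elliptic `W/ℚ` and any prime `ℓ`:
  `NoLocalThreeTorsionAt W ℓ ↔ ∀ P ∈ W(ℚ_ℓ), 3•P = 0 → P = 0`. Dictionary: an affine point
  `P = (x, y)` has `3•P = 0 ↔ ψ₃(x, y) = Ψ₃(x) = 0` (Silverman *AEC* Exercise 3.7 (d),(f); tree
  theorem `WeierstrassCurve.Affine.Point.zsmul_some_eq_zero_iff`, `DivisionPolynomialMultiplication`),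
  and on the curve `ψ₂(x, y)² = (2y + a₁x + a₃)² = Ψ₂Sq(x)` (Mathlib `C_Ψ₂Sq`, tree
  `WeierstrassCurve.eval_Ψ₂Sq_eq_sq`), so `Ψ₂Sq(x₀)` is a square `s²` iff `x₀` is the `x`-coordinate
  of a `ℚ_ℓ`-point (`y₀ = (s − a₁x₀ − a₃)/2`, `equation_of_eval_Ψ₂Sq_eq_sq`).
* §2 `noLocalThreeTorsionAt_iff_of_isCongruentModThree` — for globally minimal elliptic `C, G/ℚ`
  with `C[3]` irreducible and `IsCongruentModThree C G`, and every prime `ℓ` (including `ℓ = 3`):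
  `NoLocalThreeTorsionAt C ℓ ↔ NoLocalThreeTorsionAt G ℓ` — E109's `Gal(ℚ̄/ℚ)`-equivariant
  `C[3] ≃+ G[3]` (Darmon–Diamond–Taylor Prop. 2.6 (b)) read on `H⁰(ℚ_ℓ, ·)` by E110's
  `exists_kerEquiv_baseChange_of_equivariant` (`C(ℚ_ℓ)[3] ≃+ G(ℚ_ℓ)[3]`), then §1 on both sides;
  cardinal form `natCard_ker_three_nsmul_baseChange_eq_of_isCongruentModThree`: `#C(F)[3] = #G(F)[3]`
  for every `ℚ`-field `F` (the X11a currency `Nat.card (nsmulAddMonoidHom 3 …).ker`); `ℓ = 3` in the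
  nodes' spelling: `noLocalThreeTorsionAt_three_of_isCongruentModThree`.
* §3 the same for `FullLocalThreeTorsionAt` (`O5/O5UncleanParity.lean`, "two distinct `ℚ_ℓ`-roots of `Ψ₃`
  at which `Ψ₂²` is a square" = `h⁰(ℚ_ℓ, W[3]) = 2`): `exists_pair_three_nsmul_iff_fullLocalThreeTorsionAt`
  (two points of order `3` with `Q ≠ ±P`; `x(P) = x(Q) ↔ Q = ±P` is Mathlib `Affine.Point.X_eq_iff`)
  and `fullLocalThreeTorsionAt_iff_of_isCongruentModThree`.
* §4 `pDvdTamagawaAt_three_iff_not_noLocalThreeTorsionAt` — at an ADDITIVE prime `ℓ ≠ 3` of `W`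
  (`Rank1Residual.Addv W ℓ`): `PDvdTamagawaAt W 3 ℓ ↔ ¬ NoLocalThreeTorsionAt W ℓ` (`[3 ∣ c_ℓ] = [h⁰(ℚ_ℓ, W[3]) ≠ 0]`,
  E110 §1 + §1 here; the T27-budget dictionary at additive places).

Nothing about any particular curve is asserted; no node is discharged here; the census numbers of
the O5 files stay EVIDENCE.

References: J. H. Silverman, *The Arithmetic of Elliptic Curves*, 2nd ed. (2009), III.2.3 (d),
Exercise 3.7 (a),(d),(f), VIII.§1 [SilvermanAEC2009]; H. Darmon, F. Diamond, R. Taylor, *Fermat's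
Last Theorem* (1995), Prop. 2.6 (b) [DarmonDiamondTaylor1995]; cell: `O5/O5KummerLine.lean` §1,
`O5/AdditiveTamagawaThreeInvariantHolds.lean` (E110), `O5/CompanionTypeLawThreeHolds.lean` (E109),
HOME/b2b-bsdres-harvest-2/gen56/E111.

## Design

No definitions; `noncomputable section`; `open scoped Classical` (Mathlib's group law on
`Affine.Point` over `ℚ_[ℓ]` uses the classical `DecidableEq`). Axioms: `propext`, `Classical.choice`,
`Quot.sound`.
-/

set_option autoImplicit false

noncomputable section

open scoped Classical

namespace Summit.BirchSwinnertonDyer.Rank1Residual.O5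

open WeierstrassCurve Polynomial Literature.NumberTheory.EllipticCurves

/-! ## §1 The dictionary: `NoLocalThreeTorsionAt W ℓ ↔ W(ℚ_ℓ)[3] = 0` -/

section Dictionary

variable {F : Type*} [Field F] [CharZero F] (V : WeierstrassCurve F) [V.IsElliptic]

omit [V.IsElliptic] in
/-- If `Ψ₂Sq(x₀) = s²` then `(x₀, (s − a₁x₀ − a₃)/2)` lies on the curve (characteristic `0`):
`4·f(x₀, y₀) = ψ₂(x₀, y₀)² − Ψ₂Sq(x₀) = s² − s² = 0` (Mathlib `C_Ψ₂Sq`; converse of the tree's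
`WeierstrassCurve.eval_Ψ₂Sq_eq_sq`). Silverman *AEC* III.2.3 (d), Exercise 3.7 (a). [folklore] -/
theorem equation_of_eval_Ψ₂Sq_eq_sq {x₀ s : F} (hs : V.Ψ₂Sq.eval x₀ = s ^ 2) :
    V.toAffine.Equation x₀ ((s - V.a₁ * x₀ - V.a₃) / 2) := by
  set y₀ : F := (s - V.a₁ * x₀ - V.a₃) / 2 with hy₀
  have hψ : 2 * y₀ + V.a₁ * x₀ + V.a₃ = s := by rw [hy₀]; ring
  have h4 : (4 : Polynomial (Polynomial F)).evalEval x₀ y₀ = 4 := by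
    simp [Polynomial.evalEval]
  have e := congrArg (Polynomial.evalEval x₀ y₀) V.C_Ψ₂Sq
  rw [evalEval_C, evalEval_sub, evalEval_mul, evalEval_pow, ψ₂, Affine.evalEval_polynomialY, hψ,
    hs, h4] at e
  -- `e : s ^ 2 = s ^ 2 - 4 * f(x₀, y₀)`
  change V.toAffine.polynomial.evalEval x₀ y₀ = 0
  have h0 : (4 : F) * V.toAffine.polynomial.evalEval x₀ y₀ = 0 := by linear_combination e
  exact (mul_eq_zero.mp h0).resolve_left (by norm_num)

omit [CharZero F] [V.IsElliptic] in
/-- **An affine point `P = (x, y)` of an elliptic curve has `3•P = 0` iff `Ψ₃(x) = 0`** (Silverman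
*AEC* Exercise 3.7 (d),(f): `ψ₃` vanishes exactly on `E[3] ∖ {O}`; tree theorem
`Affine.Point.zsmul_some_eq_zero_iff`, `ψ₃ = C Ψ₃`). [cite: SilvermanAEC2009, Exercise 3.7 (d),(f)] -/
theorem three_nsmul_some_eq_zero_iff_isRoot_Ψ₃ {x y : F} (h : V.toAffine.Nonsingular x y) :
    3 • (Affine.Point.some x y h : V.toAffine.Point) = 0 ↔ V.Ψ₃.IsRoot x := by
  rw [← natCast_zsmul, show ((3 : ℕ) : ℤ) = 3 by norm_num,
    Affine.Point.zsmul_some_eq_zero_iff h 3, ψ_three, evalEval_C, IsRoot.def]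

/-- **`E(F)` has a point of order `3` iff some root `x₀ ∈ F` of `Ψ₃` has `Ψ₂Sq(x₀)` a square in `F`**
(the `x`-coordinates of the nonzero `3`-torsion points are the roots of `Ψ₃`, and `x₀` lifts to an
`F`-point iff `(2y + a₁x₀ + a₃)² = Ψ₂Sq(x₀)` is soluble in `F`; `F` of characteristic `0`).
Silverman *AEC* III.2.3 (d), Exercise 3.7. [cite: SilvermanAEC2009, Exercise 3.7 (a),(d),(f)] -/
theorem exists_ne_zero_three_nsmul_eq_zero_iff_exists_root :
    (∃ P : V.toAffine.Point, P ≠ 0 ∧ 3 • P = 0) ↔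
      ∃ x₀ s : F, V.Ψ₃.IsRoot x₀ ∧ V.Ψ₂Sq.eval x₀ = s ^ 2 := by
  constructor
  · rintro ⟨P, hP0, hP3⟩
    rcases P with _ | ⟨x, y, h⟩
    · exact absurd rfl hP0
    · exact ⟨x, 2 * y + V.a₁ * x + V.a₃, (three_nsmul_some_eq_zero_iff_isRoot_Ψ₃ V h).mp hP3,
        V.eval_Ψ₂Sq_eq_sq h.left⟩
  · rintro ⟨x₀, s, hroot, hs⟩
    have heq := equation_of_eval_Ψ₂Sq_eq_sq V hs
    have hns : V.toAffine.Nonsingular x₀ ((s - V.a₁ * x₀ - V.a₃) / 2) :=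
      (Affine.equation_iff_nonsingular (W := V.toAffine)).mp heq
    exact ⟨Affine.Point.some _ _ hns, Affine.Point.some_ne_zero hns,
      (three_nsmul_some_eq_zero_iff_isRoot_Ψ₃ V hns).mpr hroot⟩

end Dictionary

section Local

variable (W : WeierstrassCurve ℚ) [W.IsElliptic] (ℓ : ℕ) [Fact ℓ.Prime]

/-- **`¬ NoLocalThreeTorsionAt W ℓ ↔ W(ℚ_ℓ)` has a point of order `3`** — the census predicate of
`O5/O5KummerLine.lean` §1 ("no `ℚ_ℓ`-root `x₀` of `Ψ₃` with `Ψ₂²(x₀)` a square") IS `H⁰(ℚ_ℓ, W[3]) = 0`,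
as its docstring says. [cite: SilvermanAEC2009, Exercise 3.7 (d),(f) and III.2.3 (d)] -/
theorem exists_ne_zero_three_nsmul_iff_not_noLocalThreeTorsionAt :
    (∃ P : (W.baseChange ℚ_[ℓ]).toAffine.Point, P ≠ 0 ∧ 3 • P = 0) ↔ ¬ NoLocalThreeTorsionAt W ℓ := by
  rw [exists_ne_zero_three_nsmul_eq_zero_iff_exists_root (W.baseChange ℚ_[ℓ]), NoLocalThreeTorsionAt]
  constructor
  · rintro ⟨x₀, s, h1, h2⟩ hno
    exact hno x₀ s h1 h2
  · intro hno
    by_contra hne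
    exact hno fun x₀ s h1 h2 ↦ hne ⟨x₀, s, h1, h2⟩

/-- **`NoLocalThreeTorsionAt W ℓ ↔ W(ℚ_ℓ)[3] = 0`**: every `ℚ_ℓ`-point killed by `3` is `O`.
[cite: SilvermanAEC2009, Exercise 3.7 (d),(f) and III.2.3 (d)] -/
theorem noLocalThreeTorsionAt_iff_forall_three_nsmul :
    NoLocalThreeTorsionAt W ℓ ↔ ∀ P : (W.baseChange ℚ_[ℓ]).toAffine.Point, 3 • P = 0 → P = 0 := by
  have h := exists_ne_zero_three_nsmul_iff_not_noLocalThreeTorsionAt W ℓ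
  constructor
  · intro hno P hP
    by_contra hP0
    exact (h.mp ⟨P, hP0, hP⟩) hno
  · intro hall
    by_contra hno
    obtain ⟨P, hP0, hP⟩ := h.mpr hno
    exact hP0 (hall P hP)

end Local

/-! ## §2 Transport along a mod-3 congruence -/

section Transport

variable (C G : WeierstrassCurve ℚ) [C.IsElliptic] [C.IsGloballyMinimal] [G.IsElliptic]
  [G.IsGloballyMinimal]

/-- **`NoLocalThreeTorsionAt` is symmetric along a mod-3 congruence with irreducible `C[3]`**: for
every prime `ℓ` (including `ℓ = 3`), `C(ℚ_ℓ)[3] = 0 ↔ G(ℚ_ℓ)[3] = 0`. Proof: E109's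
`Gal(ℚ̄/ℚ)`-equivariant `C[3] ≃+ G[3]` (`exists_addEquiv_geomTorsion_of_isCongruentModThree'`,
Brauer–Nesbitt–Chebotarev after Darmon–Diamond–Taylor Prop. 2.6 (b)) restricts to
`C(ℚ_ℓ)[3] ≃+ G(ℚ_ℓ)[3]` (E110 `exists_kerEquiv_baseChange_of_equivariant`, Galois descent for points,
Silverman *AEC* VIII.§1), and §1 reads both sides as the census predicate. Consumers may drop the
second of two hypotheses `NoLocalThreeTorsionAt C ℓ`, `NoLocalThreeTorsionAt G ℓ` on a congruent pair.
[cite: DarmonDiamondTaylor1995, Prop. 2.6 (b) (PDF p. 53)] [cite: SilvermanAEC2009, VIII.§1 and Exercise 3.7 (f)] -/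
theorem noLocalThreeTorsionAt_iff_of_isCongruentModThree (hirr : C.HasIrreducibleModPGaloisRep 3)
    (hcong : IsCongruentModThree C G) (ℓ : ℕ) [Fact ℓ.Prime] :
    NoLocalThreeTorsionAt C ℓ ↔ NoLocalThreeTorsionAt G ℓ := by
  obtain ⟨θ, hθ⟩ := exists_addEquiv_geomTorsion_of_isCongruentModThree' C G hirr hcong
  obtain ⟨eF⟩ := exists_kerEquiv_baseChange_of_equivariant C G ℚ_[ℓ] (n := 3) (by norm_num) θ hθ
  have key := exists_ne_zero_nsmul_eq_zero_iff_of_kerEquiv (k := 3) (by norm_num) eF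
  rw [exists_ne_zero_three_nsmul_iff_not_noLocalThreeTorsionAt C ℓ,
    exists_ne_zero_three_nsmul_iff_not_noLocalThreeTorsionAt G ℓ] at key
  exact not_iff_not.mp key

/-- The symmetric reading for the companion: `G(ℚ_ℓ)[3] = 0` from `C(ℚ_ℓ)[3] = 0`. [folklore] -/
theorem noLocalThreeTorsionAt_of_isCongruentModThree (hirr : C.HasIrreducibleModPGaloisRep 3)
    (hcong : IsCongruentModThree C G) (ℓ : ℕ) [Fact ℓ.Prime] (h : NoLocalThreeTorsionAt C ℓ) :
    NoLocalThreeTorsionAt G ℓ :=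
  (noLocalThreeTorsionAt_iff_of_isCongruentModThree C G hirr hcong ℓ).mp h

/-- The `ℓ = 3` instance in the O5 nodes' spelling `@NoLocalThreeTorsionAt · 3 ⟨Nat.prime_three⟩`
(`DepthLawThree`, `SignedLevelRaisingTransferThree{,AdditivePlaces,Readings}`,
`SecondReciprocityThree`): the `G`-side hypothesis of a congruent pair follows from the `C`-side one.
[folklore] -/
theorem noLocalThreeTorsionAt_three_of_isCongruentModThree
    (hirr : C.HasIrreducibleModPGaloisRep 3) (hcong : IsCongruentModThree C G)
    (h : @NoLocalThreeTorsionAt C 3 ⟨Nat.prime_three⟩) : @NoLocalThreeTorsionAt G 3 ⟨Nat.prime_three⟩ :=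
  @noLocalThreeTorsionAt_of_isCongruentModThree C G _ _ _ _ hirr hcong 3 ⟨Nat.prime_three⟩ h

/-- `ker (3 • ·) = ker ((3 : ℤ) • ·)` on any abelian group (the `ℕ`- and `ℤ`-spellings of the
`3`-torsion subgroup used by the X11a files and by `exists_kerEquiv_baseChange_of_equivariant`).
[folklore] -/
theorem ker_nsmulAddMonoidHom_three_eq (A : Type*) [AddCommGroup A] :
    (nsmulAddMonoidHom 3 : A →+ A).ker = (zsmulAddGroupHom (3 : ℤ) : A →+ A).ker := by
  ext a
  simp only [AddMonoidHom.mem_ker, zsmulAddGroupHom_apply, nsmulAddMonoidHom_apply]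
  rw [show (3 : ℤ) = ((3 : ℕ) : ℤ) from rfl, natCast_zsmul]

/-- **`#C(F)[3] = #G(F)[3]` for every `ℚ`-field `F`** along a mod-3 congruence with irreducible
`C[3]` (the cardinal form, in the X11a currency `Nat.card (nsmulAddMonoidHom 3 …).ker`, e.g. at
`F = ℚ_v`): E109's equivariant `C[3] ≃+ G[3]` restricted to `F`-rational points (E110 §3).
[cite: DarmonDiamondTaylor1995, Prop. 2.6 (b) (PDF p. 53)] [cite: SilvermanAEC2009, VIII.§1] -/
theorem natCard_ker_three_nsmul_baseChange_eq_of_isCongruentModThree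
    (hirr : C.HasIrreducibleModPGaloisRep 3) (hcong : IsCongruentModThree C G)
    (F : Type) [Field F] [Algebra ℚ F] [CharZero F] :
    Nat.card (nsmulAddMonoidHom 3 : (C.baseChange F).toAffine.Point →+ _).ker =
      Nat.card (nsmulAddMonoidHom 3 : (G.baseChange F).toAffine.Point →+ _).ker := by
  obtain ⟨θ, hθ⟩ := exists_addEquiv_geomTorsion_of_isCongruentModThree' C G hirr hcong
  obtain ⟨eF⟩ := exists_kerEquiv_baseChange_of_equivariant C G F (n := 3) (by norm_num) θ hθ
  rw [ker_nsmulAddMonoidHom_three_eq, ker_nsmulAddMonoidHom_three_eq]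
  exact Nat.card_congr eF.toEquiv

end Transport

/-! ## §3 `FullLocalThreeTorsionAt`: `h⁰(ℚ_ℓ, W[3]) = 2`, and its transport -/

section Full

variable {F : Type*} [Field F] [CharZero F] (V : WeierstrassCurve F) [V.IsElliptic]

/-- **Two `F`-rational points of order `3` with distinct `x`-coordinates ⟺ two distinct roots of
`Ψ₃` in `F` at which `Ψ₂Sq` is a square** (the polynomial form of "`E(F)[3]` is not cyclic", i.e.
`E(F)[3] ≅ (ℤ/3)²`): §1's dictionary twice, and `x(P) = x(Q) ↔ Q = ±P` (Mathlib
`Affine.Point.X_eq_iff`). Silverman *AEC* III.2.3, Exercise 3.7. [cite: SilvermanAEC2009, Exercise 3.7 (d),(f) and III.2.3 (d)] -/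
theorem exists_pair_three_nsmul_iff_exists_roots :
    (∃ P Q : V.toAffine.Point, P ≠ 0 ∧ Q ≠ 0 ∧ 3 • P = 0 ∧ 3 • Q = 0 ∧ Q ≠ P ∧ Q ≠ -P) ↔
      ∃ x₁ x₂ s₁ s₂ : F, x₁ ≠ x₂ ∧ V.Ψ₃.IsRoot x₁ ∧ V.Ψ₃.IsRoot x₂ ∧
        V.Ψ₂Sq.eval x₁ = s₁ ^ 2 ∧ V.Ψ₂Sq.eval x₂ = s₂ ^ 2 := by
  constructor
  · rintro ⟨P, Q, hP0, hQ0, hP3, hQ3, hQP, hQnP⟩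
    rcases P with _ | ⟨x₁, y₁, h₁⟩
    · exact absurd rfl hP0
    rcases Q with _ | ⟨x₂, y₂, h₂⟩
    · exact absurd rfl hQ0
    refine ⟨x₁, x₂, 2 * y₁ + V.a₁ * x₁ + V.a₃, 2 * y₂ + V.a₁ * x₂ + V.a₃, ?_,
      (three_nsmul_some_eq_zero_iff_isRoot_Ψ₃ V h₁).mp hP3,
      (three_nsmul_some_eq_zero_iff_isRoot_Ψ₃ V h₂).mp hQ3, V.eval_Ψ₂Sq_eq_sq h₁.left,
      V.eval_Ψ₂Sq_eq_sq h₂.left⟩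
    intro hx
    rcases (Affine.Point.X_eq_iff (h₁ := h₂) (h₂ := h₁)).mp hx.symm with h | h
    · exact hQP h
    · exact hQnP h
  · rintro ⟨x₁, x₂, s₁, s₂, hx, hr₁, hr₂, hs₁, hs₂⟩
    have hn₁ := (Affine.equation_iff_nonsingular (W := V.toAffine)).mp
      (equation_of_eval_Ψ₂Sq_eq_sq V hs₁)
    have hn₂ := (Affine.equation_iff_nonsingular (W := V.toAffine)).mp
      (equation_of_eval_Ψ₂Sq_eq_sq V hs₂)
    refine ⟨Affine.Point.some _ _ hn₁, Affine.Point.some _ _ hn₂, Affine.Point.some_ne_zero hn₁,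
      Affine.Point.some_ne_zero hn₂, (three_nsmul_some_eq_zero_iff_isRoot_Ψ₃ V hn₁).mpr hr₁,
      (three_nsmul_some_eq_zero_iff_isRoot_Ψ₃ V hn₂).mpr hr₂, fun h ↦ ?_, fun h ↦ ?_⟩
    · exact hx ((Affine.Point.X_eq_iff (h₁ := hn₂) (h₂ := hn₁)).mpr (Or.inl h)).symm
    · exact hx ((Affine.Point.X_eq_iff (h₁ := hn₂) (h₂ := hn₁)).mpr (Or.inr h)).symm

omit [CharZero F] [V.IsElliptic] in
/-- One direction of the transport of "two independent `k`-torsion elements" along an isomorphism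
of the `k`-torsion kernels. [folklore] -/
theorem exists_pair_nsmul_of_kerEquiv {A B : Type*} [AddCommGroup A] [AddCommGroup B] {k : ℕ}
    (e : (zsmulAddGroupHom (k : ℤ) : A →+ A).ker ≃+ (zsmulAddGroupHom (k : ℤ) : B →+ B).ker)
    (h : ∃ P Q : A, P ≠ 0 ∧ Q ≠ 0 ∧ k • P = 0 ∧ k • Q = 0 ∧ Q ≠ P ∧ Q ≠ -P) :
    ∃ P Q : B, P ≠ 0 ∧ Q ≠ 0 ∧ k • P = 0 ∧ k • Q = 0 ∧ Q ≠ P ∧ Q ≠ -P := by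
  obtain ⟨P, Q, hP0, hQ0, hP, hQ, hQP, hQnP⟩ := h
  set P' : (zsmulAddGroupHom (k : ℤ) : A →+ A).ker :=
    ⟨P, (mem_ker_zsmulAddGroupHom_natCast_iff k P).mpr hP⟩ with hP'
  set Q' : (zsmulAddGroupHom (k : ℤ) : A →+ A).ker :=
    ⟨Q, (mem_ker_zsmulAddGroupHom_natCast_iff k Q).mpr hQ⟩ with hQ'
  have hne : ∀ R : (zsmulAddGroupHom (k : ℤ) : A →+ A).ker, (R : A) ≠ 0 → ((e R : _) : B) ≠ 0 := by
    intro R hR h0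
    have h1 : e R = 0 := Subtype.ext h0
    rw [e.map_eq_zero_iff] at h1
    exact hR (congrArg Subtype.val h1)
  refine ⟨(e P' : B), (e Q' : B), hne P' hP0, hne Q' hQ0,
    (mem_ker_zsmulAddGroupHom_natCast_iff k _).mp (e P').2,
    (mem_ker_zsmulAddGroupHom_natCast_iff k _).mp (e Q').2, fun h0 ↦ hQP ?_, fun h0 ↦ hQnP ?_⟩
  · have h1 : e Q' = e P' := Subtype.ext h0
    exact congrArg Subtype.val (e.injective h1)
  · have h1 : e Q' = -e P' := Subtype.ext h0
    rw [← map_neg] at h1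
    exact congrArg Subtype.val (e.injective h1)

end Full

section FullLocal

variable (W : WeierstrassCurve ℚ) [W.IsElliptic] (ℓ : ℕ) [Fact ℓ.Prime]

/-- **`FullLocalThreeTorsionAt W ℓ ↔ W(ℚ_ℓ)` has two points of order `3` with `Q ≠ ±P`**
(`h⁰(ℚ_ℓ, W[3]) = 2`: the census predicate of `O5/O5UncleanParity.lean`, "two distinct `ℚ_ℓ`-roots of
`Ψ₃` at which `Ψ₂²` is a square", read on points). [cite: SilvermanAEC2009, Exercise 3.7 (d),(f) and III.2.3 (d)] -/
theorem exists_pair_three_nsmul_iff_fullLocalThreeTorsionAt :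
    (∃ P Q : (W.baseChange ℚ_[ℓ]).toAffine.Point,
        P ≠ 0 ∧ Q ≠ 0 ∧ 3 • P = 0 ∧ 3 • Q = 0 ∧ Q ≠ P ∧ Q ≠ -P) ↔ FullLocalThreeTorsionAt W ℓ :=
  exists_pair_three_nsmul_iff_exists_roots (W.baseChange ℚ_[ℓ])

end FullLocal

section FullTransport

variable (C G : WeierstrassCurve ℚ) [C.IsElliptic] [C.IsGloballyMinimal] [G.IsElliptic]
  [G.IsGloballyMinimal]

/-- **`FullLocalThreeTorsionAt` is symmetric along a mod-3 congruence with irreducible `C[3]`**: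
for every prime `ℓ`, `h⁰(ℚ_ℓ, C[3]) = 2 ↔ h⁰(ℚ_ℓ, G[3]) = 2` in the census spelling — E109's
equivariant `C[3] ≃+ G[3]` restricted to `ℚ_ℓ`-points (E110 §3) preserves "two `3`-torsion points
`Q ≠ ±P`". [cite: DarmonDiamondTaylor1995, Prop. 2.6 (b) (PDF p. 53)] [cite: SilvermanAEC2009, VIII.§1 and Exercise 3.7 (f)] -/
theorem fullLocalThreeTorsionAt_iff_of_isCongruentModThree (hirr : C.HasIrreducibleModPGaloisRep 3)
    (hcong : IsCongruentModThree C G) (ℓ : ℕ) [Fact ℓ.Prime] :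
    FullLocalThreeTorsionAt C ℓ ↔ FullLocalThreeTorsionAt G ℓ := by
  obtain ⟨θ, hθ⟩ := exists_addEquiv_geomTorsion_of_isCongruentModThree' C G hirr hcong
  obtain ⟨eF⟩ := exists_kerEquiv_baseChange_of_equivariant C G ℚ_[ℓ] (n := 3) (by norm_num) θ hθ
  rw [← exists_pair_three_nsmul_iff_fullLocalThreeTorsionAt C ℓ,
    ← exists_pair_three_nsmul_iff_fullLocalThreeTorsionAt G ℓ]
  exact ⟨exists_pair_nsmul_of_kerEquiv (k := 3) eF, exists_pair_nsmul_of_kerEquiv (k := 3) eF.symm⟩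

end FullTransport

/-! ## §4 At an ADDITIVE prime `ℓ ≠ 3`: the Tamagawa bit `[3 ∣ c_ℓ]` IS the local-torsion bit `[h⁰ ≠ 0]` -/

section TamagawaBit

variable (W : WeierstrassCurve ℚ) [W.IsElliptic] (ℓ : ℕ) [Fact ℓ.Prime]

/-- **At an additive prime `ℓ ≠ 3` of `W`: `3 ∣ c_ℓ(W) ↔ W(ℚ_ℓ)[3] ≠ 0`, in the census spellings
`KunduRay2024.PDvdTamagawaAt W 3 ℓ ↔ ¬ NoLocalThreeTorsionAt W ℓ`** — E110 §1
(`dvd_localTamagawaNumber_iff_exists_of_addv`: `E₀(ℚ_ℓ)` is uniquely `3`-divisible at a cusp,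
Silverman *ATAEC* IV.9 Remark 9.2.2) composed with §1. This is the dictionary
"`h⁰(ℚ_ℓ, ρ̄) = dim Φ_ℓ(𝔽_ℓ)[3] = [3 ∣ c_ℓ]`" of the T27 budget (`O5/O5TransferCertificate.lean`,
`crudeBudgetThree`) at the additive places, as a theorem; nothing about any node is asserted.
[cite: SilvermanATAEC1994, IV.9 Remark 9.2.2 and Cor. IV.9.2 (d) (PDF p. 340)]
[cite: SilvermanAEC2009, Exercise 3.7 (d),(f)] -/
theorem pDvdTamagawaAt_three_iff_not_noLocalThreeTorsionAt (hℓ3 : ℓ ≠ 3) (hadd : Rank1Residual.Addv W ℓ) :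
    KunduRay2024.PDvdTamagawaAt W 3 ℓ ↔ ¬ NoLocalThreeTorsionAt W ℓ := by
  rw [← exists_ne_zero_three_nsmul_iff_not_noLocalThreeTorsionAt W ℓ,
    ← dvd_localTamagawaNumber_iff_exists_of_addv W ℓ Nat.prime_three hℓ3 hadd]
  exact ⟨fun ⟨_, h⟩ ↦ h, fun h ↦ ⟨inferInstance, h⟩⟩

end TamagawaBit

end Summit.BirchSwinnertonDyer.Rank1Residual.O5

end
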